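import Summits.Schanuel.Schanuel.Theorems.ZilberEacPunctureDensityPoly
import Summits.Schanuel.Schanuel.Theorems.ZilberEacComplexSecondOrder
import Mathlib.RingTheory.MvPolynomial.EulerIdentity
import HarnessLib

/-!
# Density from super-logarithmic decay along a dense set of rays; the OSCILLATORY regime

Zilber's Exponential-Algebraic Closedness, case ladder (host summit Schanuel, cell `pub-schanuel`,
seat 2, gen 9).  All the cell's existence theorems over graph hypersurface bases `x_{s+1} = g(x)`
(`polyFibredGraph g A F`) pass through `exists_expPoint_of_superlog_decay`
(`ZilberEacComplexOscillatoryBase`): `Re g ≤ -N log m` on the unit polydiscs around the lattice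
centres of a ray `2πi m q`, for every `N`.  THEOREM J′ turns this into Zariski density:

* `unprojectedDense_polyFibredGraph_of_superlog_decay` — if the super-logarithmic decay holds
  along every ray of a set of lattice directions on which no nonzero polynomial vanishes, and
  all `Aⱼ ≠ 0`, then `I(W ∩ Γ_exp) = I(W)` for `W = polyFibredGraph g A F` (any `F ∈ ℂ[u, x]`).
* `unprojectedDense_polyFibredGraph_oscillatory` — the OSCILLATORY regime of
  `ZilberEacComplexSecondOrder.exists_expPoint_of_oscillatory`: `deg g ≥ 2`, `Re g_D(2πi q) = 0`
  for ALL lattice directions (e.g. `g = x₀³ + x₁³`, `g = i x₀x₁`), and one direction `q₀` (all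
  `q₀ⱼ ≠ 0`) with the second-order sign `Σⱼ deg Aⱼ · Re ∂ⱼg_D(2πi q₀) < 0` ⟹ dense — the
  admissible directions are the integer points of the open cone of the homogeneous form
  `Σⱼ dⱼ ∂ⱼ g_D` (`coneLatticeDirections_dense`).
* `cubicModel_member_dense` — the cubic analogue of Mantova–Masser's model system,
  `{x₂ = x₀³ + x₁³, y₀ = x₀ - y₂, y₁ = x₁ - y₂}` (`e^z + e^{z³+w³} = z`, `e^w + e^{z³+w³} = w`), a
  certified member of `EC(3,2)` with NO ray of negative leading real part: Zariski dense
  exponential points.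

HONEST FRAMING: explicit families inside an OPEN cell; existence was gen 2, NEW is the Zariski
density; `EC(3,2)` OPEN; NOT Schanuel's conjecture; EAC ⇏ SC.
-/

noncomputable section

open Complex MvPolynomial Filter Topology
open Literature.NumberTheory.Transcendental Literature.ModelTheory.Zilber
  Literature.ModelTheory.ExponentialFields

set_option linter.dupNamespace false

namespace Summit.Schanuel.Schanuel.Theorems

section Superlog

variable {s : ℕ}

/-- **Density from super-logarithmic decay along a Zariski-dense set of rays.**  See the module
docstring. (new) [cite: MantovaMasser2023, §1 p.5 (the open case dim π(V) = 2 in ℂ³×ℂˣ³)] -/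
theorem unprojectedDense_polyFibredGraph_of_superlog_decay (g : MvPolynomial (Fin (s + 1)) ℂ)
    (A : Fin (s + 1) → MvPolynomial (Fin (s + 1)) ℂ) (hA0 : ∀ j, A j ≠ 0)
    (F : Fin (s + 1) → MvPolynomial (Fin (s + 2)) ℂ) (adm : (Fin (s + 1) → ℤ) → Prop)
    (hQ : ∀ G : MvPolynomial (Fin (s + 1)) ℂ, G ≠ 0 →
      ∃ q : Fin (s + 1) → ℤ, adm q ∧ eval (fun i => 2 * Real.pi * I * (q i : ℂ)) G ≠ 0)
    (hdecay : ∀ q, adm q →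
      (∀ j, eval (fun i => 2 * Real.pi * I * (q i : ℂ))
        (homogeneousComponent (A j).totalDegree (A j)) ≠ 0) →
      ∀ N : ℕ, ∀ᶠ m : ℕ in atTop, ∀ ξ : Fin (s + 1) → ℂ, ‖ξ‖ ≤ 1 →
        (eval ((fun i => (m : ℂ) * (2 * Real.pi * I * (q i : ℂ)) +
            log (eval (fun k => (m : ℂ) * (2 * Real.pi * I * (q k : ℂ))) (A i))) + ξ) g).re ≤
          -(N * Real.log m)) :
    UnprojectedDense (polyFibredGraph g A F) := by
  classical
  set LA : MvPolynomial (Fin (s + 1)) ℂ := ∏ j, homogeneousComponent (A j).totalDegree (A j) with hLA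
  have hLA0 : LA ≠ 0 := Finset.prod_ne_zero_iff.2 fun j _ =>
    ExpDominant.homogeneousComponent_totalDegree_ne_zero (hA0 j)
  refine unprojectedDense_of_directional_decay (t := s + 1) (isIrreducibleClosed_polyFibredGraph g A F)
    (by rw [zariskiDim_polyFibredGraph]) (fun i => Sum.inl (Fin.castSucc i)) (Sum.inr (Fin.last (s + 1)))
    (Q := {v : Fin (s + 1) → ℂ | ∃ q : Fin (s + 1) → ℤ, (v = fun i => 2 * Real.pi * I * (q i : ℂ)) ∧
      adm q ∧ eval (fun i => 2 * Real.pi * I * (q i : ℂ)) LA ≠ 0})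
    (fun G hG => ?_) ?_
  · obtain ⟨q, hq, hGq⟩ := hQ (G * LA) (mul_ne_zero hG hLA0)
    rw [map_mul] at hGq
    exact ⟨_, ⟨q, rfl, hq, right_ne_zero_of_mul hGq⟩, left_ne_zero_of_mul hGq⟩
  rintro v ⟨q, rfl, hq, hqA⟩
  have hA : ∀ j, eval (fun i => 2 * Real.pi * I * (q i : ℂ))
      (homogeneousComponent (A j).totalDegree (A j)) ≠ 0 := by
    rw [hLA, map_prod] at hqA
    exact fun j => (Finset.prod_ne_zero_iff.1 hqA) j (Finset.mem_univ j)
  have hdec := hdecay q hq hA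
  -- existence along the ray, and a choice of solutions
  have hsol := exists_expPoint_of_superlog_decay g q A hA F hdec
  set good : ℕ → (Fin (s + 1) → ℂ) → Prop := fun m x =>
    ‖x - fun i => (m : ℂ) * (2 * Real.pi * I * (q i : ℂ)) +
        log (eval (fun k => (m : ℂ) * (2 * Real.pi * I * (q k : ℂ))) (A i))‖ ≤ 1 / 2 ∧
      ∀ j, exp (x j) = eval x (A j) + exp (eval x g) * eval (Fin.cons (exp (eval x g)) x) (F j)
    with hgood
  set xs : ℕ → Fin (s + 1) → ℂ := fun m => Classical.epsilon (good m) with hxs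
  have hxs : ∀ᶠ m : ℕ in atTop, good m (xs m) := by
    filter_upwards [hsol] with m hm
    exact Classical.epsilon_spec hm
  set p : ℕ → Fin (s + 2) ⊕ Fin (s + 2) → ℂ := fun m =>
    pgParam g A F (xs m) (exp (eval (xs m) g)) with hp
  obtain ⟨K, hK0, hK⟩ := latticeCentre_control_of_leadingForm A _
    (fun i => re_two_pi_I_mul_int (q i)) hA
  refine ⟨p, ?_, ⟨K, ?_⟩, ?_, ?_⟩
  · filter_upwards [hxs] with m hm
    exact ⟨pgParam_mem g A F _ _, pgParam_mem_expGraph_of_solution g A F hm.2⟩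
  · filter_upwards [hxs, hK] with m hm hKm
    have hcoord : (fun i => p m (Sum.inl (Fin.castSucc i))) = xs m := by
      funext i; simp [hp]
    rw [hcoord]
    exact (hKm (xs m) hm.1).1
  · filter_upwards with m
    simp only [hp, pgParam_inr, pMulParam_last]
    exact Complex.exp_ne_zero _
  · -- `-Re g(x_m) ≥ N log m` for every `N`
    rw [tendsto_atTop]
    intro b
    obtain ⟨N, hN⟩ := exists_nat_gt b
    filter_upwards [hxs, hdec N, eventually_gt_atTop 2] with m hm hmN hm2
    have hlog : 0 < Real.log m := Real.log_pos (by exact_mod_cast (show 1 < m by omega))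
    simp only [hp, pgParam_inr, pMulParam_last, Complex.norm_exp, Real.log_exp]
    set centre : Fin (s + 1) → ℂ := fun i => (m : ℂ) * (2 * Real.pi * I * (q i : ℂ)) +
      log (eval (fun k => (m : ℂ) * (2 * Real.pi * I * (q k : ℂ))) (A i)) with hcentre
    have hξ : ‖xs m - centre‖ ≤ 1 := hm.1.trans (by norm_num)
    have h := hmN (xs m - centre) hξ
    rw [add_sub_cancel] at h
    rw [le_div_iff₀ hlog]
    nlinarith [h, hN.le, hlog]

end Superlog

/-! ## The oscillatory regime -/

section Oscillatory

variable {s : ℕ}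

/-- The second-order form `Σⱼ dⱼ ∂ⱼ g_D` is homogeneous of degree `D - 1`. [folklore] -/
theorem isHomogeneous_sum_C_mul_pderiv (g : MvPolynomial (Fin (s + 1)) ℂ) (d : Fin (s + 1) → ℕ) :
    (∑ j, C ((d j : ℕ) : ℂ) * pderiv j (homogeneousComponent g.totalDegree g)).IsHomogeneous
      (g.totalDegree - 1) := by
  refine IsHomogeneous.sum _ _ _ fun j _ => ?_
  have h := (isHomogeneous_C (Fin (s + 1)) ((d j : ℕ) : ℂ)).mul
    ((homogeneousComponent_isHomogeneous g.totalDegree g).pderiv (i := j))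
  rwa [zero_add] at h

/-- Its real part at `2πi q` is the second-order sign `Σⱼ dⱼ Re ∂ⱼg_D(2πi q)`. [folklore] -/
theorem re_eval_sum_C_mul_pderiv (g : MvPolynomial (Fin (s + 1)) ℂ) (d : Fin (s + 1) → ℕ)
    (v : Fin (s + 1) → ℂ) :
    (eval v (∑ j, C ((d j : ℕ) : ℂ) * pderiv j (homogeneousComponent g.totalDegree g))).re =
      ∑ j, (d j : ℝ) * (eval v (pderiv j (homogeneousComponent g.totalDegree g))).re := by
  rw [map_sum, Complex.re_sum]
  refine Finset.sum_congr rfl fun j _ => ?_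
  rw [map_mul, eval_C, show ((d j : ℕ) : ℂ) = ((d j : ℝ) : ℂ) by push_cast; rfl,
    Complex.re_ofReal_mul]

/-- **Super-logarithmic decay in the oscillatory regime** (the decay step of
`exists_expPoint_of_oscillatory`, isolated): `deg g ≥ 2`, `Re g_D(2πi q) = 0`, leading forms of
`Aⱼ` non-vanishing at `2πi q`, `Σⱼ deg Aⱼ Re ∂ⱼg_D(2πi q) < 0` ⟹ for every `N`, eventually
`Re g ≤ -N log m` on the unit polydisc around the `m`-th lattice centre. [folklore] -/
theorem superlog_decay_of_oscillatory (g : MvPolynomial (Fin (s + 1)) ℂ) (hD : 2 ≤ g.totalDegree)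
    (q : Fin (s + 1) → ℤ)
    (hre : (eval (fun j => 2 * Real.pi * I * (q j : ℂ)) (homogeneousComponent g.totalDegree g)).re = 0)
    (A : Fin (s + 1) → MvPolynomial (Fin (s + 1)) ℂ)
    (hA : ∀ j, eval (fun i => 2 * Real.pi * I * (q i : ℂ))
      (homogeneousComponent (A j).totalDegree (A j)) ≠ 0)
    (hκ : ∑ j, ((A j).totalDegree : ℝ) * (eval (fun i => 2 * Real.pi * I * (q i : ℂ))
      (pderiv j (homogeneousComponent g.totalDegree g))).re < 0) (N : ℕ) :
    ∀ᶠ m : ℕ in atTop, ∀ ξ : Fin (s + 1) → ℂ, ‖ξ‖ ≤ 1 →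
      (eval ((fun i => (m : ℂ) * (2 * Real.pi * I * (q i : ℂ)) +
          log (eval (fun k => (m : ℂ) * (2 * Real.pi * I * (q k : ℂ))) (A i))) + ξ) g).re ≤
        -(N * Real.log m) := by
  classical
  set v : Fin (s + 1) → ℂ := fun j => 2 * Real.pi * I * (q j : ℂ) with hv
  set a : Fin (s + 1) → ℝ := fun j => ‖eval v (homogeneousComponent (A j).totalDegree (A j))‖ with ha
  set C : ℝ := 1 + Real.pi + ∑ j, (|Real.log (a j / 2)| + |Real.log (2 * a j)|) with hCdef
  have hsum0 : 0 ≤ ∑ j, (|Real.log (a j / 2)| + |Real.log (2 * a j)|) :=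
    Finset.sum_nonneg fun j _ => by positivity
  have hC0 : 0 ≤ C := by have := Real.pi_pos; rw [hCdef]; positivity
  have hCj : ∀ j, |Real.log (a j / 2)| + |Real.log (2 * a j)| ≤
      ∑ i, (|Real.log (a i / 2)| + |Real.log (2 * a i)|) := fun j =>
    Finset.single_le_sum (f := fun i => |Real.log (a i / 2)| + |Real.log (2 * a i)|)
      (fun i _ => by positivity) (Finset.mem_univ j)
  have hbox := re_eval_le_of_secondOrder g v hD hre (fun j => (A j).totalDegree) hC0 hκ N
  filter_upwards [hbox, eventually_all.2 fun j => latticeValue_eventually (A j) v (hA j)]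
    with m hm hlv
  intro ξ hξ
  set η : Fin (s + 1) → ℂ := (fun i => log (eval (fun k => (m : ℂ) * v k) (A i))) + ξ with hη
  have hsplit : (fun i => (m : ℂ) * v i + log (eval (fun k => (m : ℂ) * v k) (A i))) + ξ =
      (fun i => (m : ℂ) * v i) + η := by
    funext i; simp only [hη, Pi.add_apply]; ring
  rw [hsplit]
  have hξj : ∀ j, ‖ξ j‖ ≤ 1 := fun j => (norm_le_pi_norm ξ j).trans hξ
  refine hm η (fun j => ?_) (fun j => ?_)
  · obtain ⟨-, ⟨h1, h2⟩, -⟩ := hlv j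
    have hre' : (η j).re = Real.log ‖eval (fun k => (m : ℂ) * v k) (A j)‖ + (ξ j).re := by
      simp only [hη, Pi.add_apply, Complex.add_re, Complex.log_re]
    have h3 : |(ξ j).re| ≤ 1 := (Complex.abs_re_le_norm _).trans (hξj j)
    rw [hre', abs_le]
    rw [abs_le] at h3
    have h4 : -|Real.log (a j / 2)| ≤ Real.log (a j / 2) := neg_abs_le _
    have h5 : Real.log (2 * a j) ≤ |Real.log (2 * a j)| := le_abs_self _
    have h6 := hCj j
    have h7 : 0 ≤ |Real.log (2 * a j)| := abs_nonneg _
    have h8 : 0 ≤ |Real.log (a j / 2)| := abs_nonneg _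
    have hpi := Real.pi_pos
    constructor <;> linarith
  · have him' : (η j).im = arg (eval (fun k => (m : ℂ) * v k) (A j)) + (ξ j).im := by
      simp only [hη, Pi.add_apply, Complex.add_im, Complex.log_im]
    have h3 : |(ξ j).im| ≤ 1 := (Complex.abs_im_le_norm _).trans (hξj j)
    have h4 : |arg (eval (fun k => (m : ℂ) * v k) (A j))| ≤ Real.pi := Complex.abs_arg_le_pi _
    rw [him']
    refine (abs_add_le _ _).trans ?_
    rw [hCdef]
    linarith

/-- **THEOREM (density in the oscillatory regime).**  `deg g ≥ 2`, `Re g_D(2πi q) = 0` for all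
lattice directions `q`, all `Aⱼ ≠ 0`, and one direction `q₀` with all `q₀ⱼ ≠ 0` and
`Σⱼ deg Aⱼ · Re ∂ⱼ g_D(2πi q₀) < 0` ⟹ the exponential points of `polyFibredGraph g A F` are
Zariski dense, for every `F ∈ ℂ[u, x]`. (new)
[cite: MantovaMasser2023, §1 p.5 (the open case dim π(V) = 2 in ℂ³×ℂˣ³)] -/
theorem unprojectedDense_polyFibredGraph_oscillatory (g : MvPolynomial (Fin (s + 1)) ℂ)
    (hD : 2 ≤ g.totalDegree)
    (hre : ∀ q : Fin (s + 1) → ℤ, (eval (fun j => 2 * Real.pi * I * (q j : ℂ))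
      (homogeneousComponent g.totalDegree g)).re = 0)
    (A : Fin (s + 1) → MvPolynomial (Fin (s + 1)) ℂ) (hA0 : ∀ j, A j ≠ 0) (q₀ : Fin (s + 1) → ℤ)
    (hq₀0 : ∀ j, q₀ j ≠ 0)
    (hκ : ∑ j, ((A j).totalDegree : ℝ) * (eval (fun i => 2 * Real.pi * I * (q₀ i : ℂ))
      (pderiv j (homogeneousComponent g.totalDegree g))).re < 0)
    (F : Fin (s + 1) → MvPolynomial (Fin (s + 2)) ℂ) :
    UnprojectedDense (polyFibredGraph g A F) := by
  set L' : MvPolynomial (Fin (s + 1)) ℂ :=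
    ∑ j, C (((A j).totalDegree : ℕ) : ℂ) * pderiv j (homogeneousComponent g.totalDegree g) with hL'
  have hL'hom := isHomogeneous_sum_C_mul_pderiv g (fun j => (A j).totalDegree)
  have hq₀ : (eval (fun j => 2 * Real.pi * I * (q₀ j : ℂ)) L').re < 0 := by
    rw [hL', re_eval_sum_C_mul_pderiv]; exact hκ
  refine unprojectedDense_polyFibredGraph_of_superlog_decay g A hA0 F
    (fun q => (eval (fun j => 2 * Real.pi * I * (q j : ℂ)) L').re < 0) (fun G hG => ?_)
    (fun q hq hA N => ?_)
  · obtain ⟨q, hq, -, hGq⟩ := coneLatticeDirections_dense hL'hom hq₀ hq₀0 G hG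
    exact ⟨q, hq, hGq⟩
  · have hκq : ∑ j, ((A j).totalDegree : ℝ) * (eval (fun i => 2 * Real.pi * I * (q i : ℂ))
        (pderiv j (homogeneousComponent g.totalDegree g))).re < 0 := by
      rw [← re_eval_sum_C_mul_pderiv]; exact hq
    exact superlog_decay_of_oscillatory g hD q (hre q) A hA hκq N

/-- With `A` dominant: certified member of `EC(s+2, s+1)`, not linearly split, dense. (new)
[cite: MantovaMasser2023, §1 p.5 (the open case dim π(V) = 2 in ℂ³×ℂˣ³)] -/
theorem polyFibredGraph_oscillatory_member_dense (g : MvPolynomial (Fin (s + 1)) ℂ)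
    (hD : 2 ≤ g.totalDegree)
    (hre : ∀ q : Fin (s + 1) → ℤ, (eval (fun j => 2 * Real.pi * I * (q j : ℂ))
      (homogeneousComponent g.totalDegree g)).re = 0)
    (A : Fin (s + 1) → MvPolynomial (Fin (s + 1)) ℂ)
    (hA : Function.Injective (aeval A : MvPolynomial (Fin (s + 1)) ℂ →ₐ[ℂ] MvPolynomial (Fin (s + 1)) ℂ))
    (q₀ : Fin (s + 1) → ℤ) (hq₀0 : ∀ j, q₀ j ≠ 0)
    (hκ : ∑ j, ((A j).totalDegree : ℝ) * (eval (fun i => 2 * Real.pi * I * (q₀ i : ℂ))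
      (pderiv j (homogeneousComponent g.totalDegree g))).re < 0)
    (F : Fin (s + 1) → MvPolynomial (Fin (s + 2)) ℂ) :
    (IsIrreducibleClosed ℂ (polyFibredGraph g A F) ∧
      (polyFibredGraph g A F ∩ torusLocus ℂ (s + 2)).Nonempty ∧
      IsRotund ℂ (s + 2) (polyFibredGraph g A F ∩ torusLocus ℂ (s + 2)) ∧
      IsAddFree ℂ (s + 2) (polyFibredGraph g A F ∩ torusLocus ℂ (s + 2)) ∧
      IsMulFree ℂ (s + 2) (polyFibredGraph g A F ∩ torusLocus ℂ (s + 2)) ∧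
      zariskiDim ℂ (polyFibredGraph g A F) = (s + 2 : ℕ) ∧
      addProjDim ℂ (s + 2) (polyFibredGraph g A F) = (s + 1 : ℕ)) ∧
    ¬ IsLinearSplit ℂ (s + 2) (polyFibredGraph g A F) ∧
    UnprojectedDense (polyFibredGraph g A F) := by
  have hA0 : ∀ j, A j ≠ 0 := by
    intro j hj
    have h1 : (aeval A : MvPolynomial (Fin (s + 1)) ℂ →ₐ[ℂ] MvPolynomial (Fin (s + 1)) ℂ) (X j) =
        (aeval A : MvPolynomial (Fin (s + 1)) ℂ →ₐ[ℂ] MvPolynomial (Fin (s + 1)) ℂ) 0 := by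
      rw [aeval_X, hj, map_zero]
    exact X_ne_zero j (hA h1)
  exact ⟨ecCell_hypotheses_polyFibredGraph g A F hA hD,
    not_isLinearSplit_polyFibredGraph g A F (Nat.succ_pos s) hA,
    unprojectedDense_polyFibredGraph_oscillatory g hD hre A hA0 q₀ hq₀0 hκ F⟩

/-- **The cubic analogue of Mantova–Masser's model system**: `W₃ = {x₂ = x₀³ + x₁³, y₀ = x₀ - y₂,
y₁ = x₁ - y₂}` (`e^z + e^{z³+w³} = z`, `e^w + e^{z³+w³} = w`), a 3-fold of `EC(3,2)` over a base
with NO ray of negative leading real part (`Re (2πi)³(q₀³ + q₁³) = 0`): certified member, not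
linearly split, and Zariski dense exponential points. (new)
[cite: MantovaMasser2023, §1 p.5 (the open case dim π(V) = 2 in ℂ³×ℂˣ³)] -/
theorem cubicModel_member_dense :
    (IsIrreducibleClosed ℂ (polyFibredGraph (X 0 ^ 3 + X 1 ^ 3 : MvPolynomial (Fin 2) ℂ)
        (fun j => X j) (fun _ => C (-1))) ∧
      (polyFibredGraph (X 0 ^ 3 + X 1 ^ 3 : MvPolynomial (Fin 2) ℂ) (fun j => X j) (fun _ => C (-1)) ∩
        torusLocus ℂ 3).Nonempty ∧
      IsRotund ℂ 3 (polyFibredGraph (X 0 ^ 3 + X 1 ^ 3 : MvPolynomial (Fin 2) ℂ) (fun j => X j)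
        (fun _ => C (-1)) ∩ torusLocus ℂ 3) ∧
      IsAddFree ℂ 3 (polyFibredGraph (X 0 ^ 3 + X 1 ^ 3 : MvPolynomial (Fin 2) ℂ) (fun j => X j)
        (fun _ => C (-1)) ∩ torusLocus ℂ 3) ∧
      IsMulFree ℂ 3 (polyFibredGraph (X 0 ^ 3 + X 1 ^ 3 : MvPolynomial (Fin 2) ℂ) (fun j => X j)
        (fun _ => C (-1)) ∩ torusLocus ℂ 3) ∧
      zariskiDim ℂ (polyFibredGraph (X 0 ^ 3 + X 1 ^ 3 : MvPolynomial (Fin 2) ℂ) (fun j => X j)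
        (fun _ => C (-1))) = (3 : ℕ) ∧
      addProjDim ℂ 3 (polyFibredGraph (X 0 ^ 3 + X 1 ^ 3 : MvPolynomial (Fin 2) ℂ) (fun j => X j)
        (fun _ => C (-1))) = (2 : ℕ)) ∧
    ¬ IsLinearSplit ℂ 3 (polyFibredGraph (X 0 ^ 3 + X 1 ^ 3 : MvPolynomial (Fin 2) ℂ) (fun j => X j)
        (fun _ => C (-1))) ∧
    UnprojectedDense (polyFibredGraph (X 0 ^ 3 + X 1 ^ 3 : MvPolynomial (Fin 2) ℂ) (fun j => X j)
        (fun _ => C (-1))) := by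
  classical
  set g : MvPolynomial (Fin 2) ℂ := X 0 ^ 3 + X 1 ^ 3 with hg
  have hhom : g.IsHomogeneous 3 := (isHomogeneous_X_pow 0 3).add (isHomogeneous_X_pow 1 3)
  have heval : ∀ x : Fin 2 → ℂ, eval x g = x 0 ^ 3 + x 1 ^ 3 := fun x => by
    simp [hg, map_add, map_pow, eval_X]
  have hg0 : g ≠ 0 := by
    intro h
    have := heval ![1, 0]
    rw [h, map_zero] at this
    norm_num at this
  have hdeg : g.totalDegree = 3 := hhom.totalDegree hg0
  have hgD : homogeneousComponent g.totalDegree g = g := by rw [hdeg, homogeneousComponent_eq_self hhom]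
  have hA : Function.Injective (aeval (fun j : Fin 2 => (X j : MvPolynomial (Fin 2) ℂ)) :
      MvPolynomial (Fin 2) ℂ →ₐ[ℂ] MvPolynomial (Fin 2) ℂ) := by
    rw [aeval_X_left]; exact fun _ _ h => h
  have hre : ∀ q : Fin 2 → ℤ, (eval (fun j => 2 * Real.pi * I * (q j : ℂ))
      (homogeneousComponent g.totalDegree g)).re = 0 := by
    intro q
    rw [hgD, heval]
    have h1 : (2 * (Real.pi : ℂ) * I * ((q 0 : ℤ) : ℂ)) ^ 3 + (2 * Real.pi * I * ((q 1 : ℤ) : ℂ)) ^ 3 =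
        ((-8 * Real.pi ^ 3 * ((q 0 : ℝ) ^ 3 + (q 1 : ℝ) ^ 3) : ℝ) : ℂ) * I := by
      push_cast
      have hI3 : I ^ 3 = -I := by rw [pow_succ, Complex.I_sq]; ring
      ring_nf
      rw [hI3]
      ring
    rw [h1, Complex.re_ofReal_mul, Complex.I_re, mul_zero]
  -- the second-order form at `q₀ = (1, 1)`: `∂ⱼ g = 3 Xⱼ²`, `Re 3(2πi)² = -12π² < 0`
  have hpd : ∀ j : Fin 2, pderiv j g = C (3 : ℂ) * X j ^ 2 := by
    intro j
    fin_cases j <;> simp [hg, map_add, pderiv_X] <;> exact (map_ofNat C 3).symm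
  have hκ : ∑ j : Fin 2, (((fun j : Fin 2 => (X j : MvPolynomial (Fin 2) ℂ)) j).totalDegree : ℝ) *
      (eval (fun i => 2 * Real.pi * I * (((![1, 1] : Fin 2 → ℤ) i : ℤ) : ℂ))
        (pderiv j (homogeneousComponent g.totalDegree g))).re < 0 := by
    rw [hgD, Fin.sum_univ_two]
    simp only [totalDegree_X, hpd, map_mul, eval_C, map_pow, eval_X, Matrix.cons_val_zero,
      Matrix.cons_val_one, Nat.cast_one, one_mul]
    have h2 : ((3 : ℂ) * (2 * Real.pi * I * ((1 : ℤ) : ℂ)) ^ 2).re = -12 * Real.pi ^ 2 := by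
      have : (3 : ℂ) * (2 * Real.pi * I * ((1 : ℤ) : ℂ)) ^ 2 = ((-12 * Real.pi ^ 2 : ℝ) : ℂ) := by
        push_cast
        ring_nf
        rw [Complex.I_sq]
        ring
      rw [this, Complex.ofReal_re]
    rw [h2]
    have := Real.pi_pos
    nlinarith
  exact polyFibredGraph_oscillatory_member_dense g (by rw [hdeg]; norm_num) hre _ hA ![1, 1]
    (fun j => by fin_cases j <;> simp) hκ _

end Oscillatory

end Summit.Schanuel.Schanuel.Theorems

end
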